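import Summits.Langlands.Langlands.Theses.NonParallelVoid
import Literature.NumberTheory.GaloisRepresentations.LabelledWeightsTateTwist
import Literature.NumberTheory.GaloisRepresentations.PstWeilDeligneTateTwist
import Literature.NumberTheory.GaloisRepresentations.OrdinaryTwistedDeterminant

/-!
# Disproof of `LocallyReducibleParallel` — findings (crux stmt-Langlands-17002, route NonParallelVoid)

Standing disprover: refuter-cdisprove-stmt-Langlands-17002-0, cycle 1 (2026-08-17).

## Verdict of cycle 1: NO KILL — the crux resists every cheap attack, for a structural reason

The crux (rank 5, "nearly ordinary sector") says: `F` imaginary quadratic, `p` any prime,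
`ρ : Γ_F →ₜ* GL₂(ℚ̄_p)` irreducible, unramified a.e., de Rham at every `v ∣ p` for THE pinned datum
`fontainePstAdicCompletion v p hv` with two DISTINCT `τ`-labelled Hodge–Tate weights at every label
`(v, τ)`, and with an invariant line at every `v ∣ p` ⟹ all labels have the same gap.

* **Formal reading (confirmed, §0).**  The period ring of the pinned datum is the CONSTRUCTION
  `bdRPeriodRingData` (Fontaine's `B_dR(F_v)`) and its `ℚ_p`-structure is the canonical one, both
  UNCONDITIONALLY (`fontainePstAdicCompletion_𝔅_eq_bdRPeriodRingData`,
  `fontainePstAdicCompletion_algebra_eq_adicCompletionPadicAlgebra`), so `HT_τ` is Fontaine's genuine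
  labelled weight, the label type `F_v →ₐ[ℚ_p] ℚ̄_p` has `[F_v : ℚ_p]` elements (two labels in all:
  one at each of `v ≠ w` if `p` splits, two at the unique `v` otherwise), `PadicAlgCl p` carries the
  `p`-adic (spectral-norm) topology, `toLocal` restricts along a genuine decomposition embedding
  (`absGaloisRestrict`), `{a, b} = a ::ₘ {b}` (checked `rfl`), and the conclusion
  `∃ g, ∀ (v,τ), ∃ a, HT = {a, a+g}` quantifies `g` BEFORE the labels (`g` may be negative; `|g|` is
  the common gap).  No junk operator, no vacuous binder, no universe restriction.  The statement is a
  faithful special case of the Calegari–Mazur parallel-weight prediction (CalegariMazur2008 Conj. 1.3,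
  §2.4) = "Fontaine–Mazur + Harder/Clozel purity" on the nearly ordinary locus.
* **Why no counterexample can be WRITTEN DOWN (§3).**  A witness against the crux is an irreducible
  geometric `ρ` over an imaginary quadratic field with non-parallel regular weights — a counterexample
  to Fontaine–Mazur (B) for `GL₂/F` (cuspidal cohomological `π` on `GL₂/F` have parallel weight by
  Clozel's purity lemma / Harder).  None is known in print (lit: CalegariMazur2008 §1, §8 computed
  families have NO classical non-parallel specialisations; Childers arXiv:2001.04956 constructs
  non-parallel OVERCONVERGENT points, not de Rham ones; Calegari2010 Thm 1.4 and ACC+ 2023 Thm 6.1.2 +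
  Rem 6.1.3 PROVE voidness on the big-image ordinary split locus).  The induced sector is provably
  void on paper: `ρ = Ind_{Γ_L}^{Γ_F} ψ` with `ψ` Hodge–Tate forces `ψ` of CM (Serre) type, whence
  HT-IRREGULAR labels if `L` is not CM and EQUAL gaps if `L = F·K₀` is biquadratic CM (§3, paper).
* **Why no counterexample can be CONSTRUCTED IN LEAN (§2–§3).**  The only representations whose
  `B_dR`-labelled weights the tree computes are: unramified / finite-image (`{0,…,0}`, files
  `BdRUnramified`, `BdRFiniteImage`), powers of the cyclotomic character (`{-m}`, clause (F11)) and
  Tate twists of anything (`HT ↦ HT - j`, `labelledHodgeTateWeightsAt_twist_of_cyclotomic_zpow`,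
  unconditional).  All of these are LABEL-INDEPENDENT operations, so every Lean-constructible `ρ` has
  the same weight multiset at both labels — parallel by construction.  §2 makes the twist part of this
  precise and kernel-checked: the set of counterexamples to the crux is stable under `ρ ↦ ρ ⊗ ε_p^{-k}`
  (conclusion, regularity, flags, irreducibility, ramification are twist-invariant; de Rham-ness
  under the T0 fact `FontaineDatumExists`), i.e. twisting can neither create nor destroy a witness,
  and provers may normalise one weight to `0` at a chosen label for free.
* **Load-bearing hypotheses (§1, paper witnesses; no Lean witness is constructible, see above).**
  `IsTotallyComplex` (real quadratic `F`: ordinary Hilbert newforms of weight `(2,4)`),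
  `IsQuadraticExtension ℚ F` (quartic CM `F ⊇ F⁺`: base change of the same forms has gaps
  `1,1,3,3`), irreducibility (`1 ⊕ χ` with `χ` the `p`-adic avatar of a Hecke character of `F` of
  infinity type `(2,1)`: gaps `2 ≠ 1`, trivially nearly ordinary) are each NECESSARY — any proof must
  use all three.  The flag hypothesis dropped is `Target` itself (open, not refutable).  `a < b` at
  EVERY label is conjecturally NOT load-bearing beyond one label (purity forces irregularity to
  propagate), recorded as information only.
* **Line `potaut` (§4).**  No stub is refutable in Lean: stubs 1–3 conclude `∃ π :
  CuspidalAutomorphicRepData 2 F' _`, a type with NO constructible term in the tree (named fact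
  `nonempty_cuspidalAutomorphicRepData_two`), so neither a proof nor a refutation can touch them;
  stub 4 takes such a `π` as hypothesis (irrefutable for the same reason); stub 5 is landed (p165845).
  Paper audit of the printed engines behind stubs 1–2 (ACC+ Thm 6.1.2 = arXiv:1812.09999 p. 64,
  Miagkov–Thorne Thm 1.3 = arXiv:2203.04520 p. 3, both read this cycle): both require
  "∃ σ ∈ G_F ∖ G_{F(ζ_p)} with ρ̄(σ) scalar".  FINDING (a), positive: in stub 1's regime (`7 ≤ p`
  split) this hypothesis is AUTOMATIC — `p` split ⇒ `F ∩ ℚ(ζ_p) = ℚ` ⇒ `[F(ζ_p):F] = p-1 ≥ 6`, while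
  an irreducible finite subgroup of `PGL₂(𝔽̄_p)` (dihedral, `A₄`, `S₄`, `A₅`, `PSL₂(q)`, `PGL₂(q)`) has
  no cyclic quotient of order `> 3` (ACC+ Rem 6.1.4).  FINDING (b), a coverage gap in stub 2's card:
  the hypothesis FAILS identically (over `F` and over every `F'/F`) for `p = 2` (any `F`), for
  `p = 3, F = ℚ(√-3)` (`F(ζ_3) = F`), and for `p = 7, F = ℚ(√-7)` with projectively tetrahedral `ρ̄`
  whose `A₄ ↠ C₃` quotient cuts out `F(ζ_7)` (`[F(ζ_7):F] = 3`) — a third open sub-corner of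
  `stub_potAut_bigImageResidue` besides "mixed signs" and "`p ≤ 5` adequacy".  Neither finding
  falsifies a stub.

## Index
* §0 `Hyp`/`Concl` vocabulary; `locallyReducibleParallel_iff` (`Iff.rfl`): the crux restated.
* §1 Load-bearing analysis: `LocallyReducibleParallelWithoutTotallyComplex`, `…WithoutQuadratic`,
  `…WithoutIrreducible`, `…WithoutFlag` (`= Target`, `Iff.rfl`), strengthening `UniformWeights`;
  paper witnesses in the docstrings; `withoutFlag_iff_target`.
* §2 Twist stability (PROVED, sorry-free): `HT_twist`, `parallelAt_twist_iff`, `regularAt_twist_iff`,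
  `flag_twist`, `irreducible_twist`, `unramified_twist`, `deRham_twist` (under `FontaineDatumExists`),
  `IsCounterexample.twist` — the counterexample locus is `ε_p^{-k}`-stable.
  LANDED (definition-free restatement) as `Summits/Langlands/Langlands/Theorems/LocallyReducibleParallel/
  Negative/TwistStable.lean` (proposal p167798): `locallyReducibleParallel_witness_twist`,
  `parallelLabels_twist_iff` — importable by ideators/planners/provers.
* §3 Constructibility obstruction and the induced sector (documentation).
* §4 `-- Line potaut`: stub-by-stub record; findings (a), (b) above.
* §5 Near-misses: none (`sorry`-free file).
-/

noncomputable section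

set_option linter.dupNamespace false

namespace Summit.Langlands.Langlands.Cruxes.LocallyReducibleParallel.Disproof

open Literature.NumberTheory.GaloisRepresentations Literature.NumberTheory.PAdicHodge
open IsDedekindDomain Field
open scoped NumberField

/-! ## §0 Vocabulary: the crux as `Hyp → Concl` -/

section Vocabulary

variable {F : Type} [Field F] [NumberField F] {p : ℕ} [Fact p.Prime]

/-- `HT ρ v hv τ`: the `τ`-labelled Hodge–Tate weights of `ρ|Γ_{F_v}` for THE pinned datum at `v ∣ p`
(shorthand for the term appearing in the crux). [folklore] -/
abbrev HT (ρ : FramedGaloisRep F (PadicAlgCl p) 2) (v : HeightOneSpectrum (𝓞 F))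
    (hv : ((p : ℕ) : 𝓞 F) ∈ v.asIdeal) (τ : v.adicCompletion F →+* PadicAlgCl p) : Multiset ℤ :=
  ρ.labelledHodgeTateWeightsAt v (fontainePstAdicCompletion v p hv).algebra
    (fontainePstAdicCompletion v p hv).𝔅 τ

/-- The crux's local hypothesis at `v ∣ p`: de Rham for the pinned datum and two distinct labelled
weights at every `ℚ_p`-label of `F_v`. [folklore] -/
def RegularHyp (ρ : FramedGaloisRep F (PadicAlgCl p) 2) : Prop :=
  ∀ (v : HeightOneSpectrum (𝓞 F)) (hv : ((p : ℕ) : 𝓞 F) ∈ v.asIdeal),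
    (fontainePstAdicCompletion v p hv).IsDeRhamFramed (ρ.toLocal v) ∧
      (letI := (fontainePstAdicCompletion v p hv).algebra
       ∀ τ : v.adicCompletion F →ₐ[ℚ_[p]] PadicAlgCl p, ∃ a b : ℤ, a < b ∧ HT ρ v hv τ.toRingHom = {a, b})

/-- The crux's "nearly ordinary" hypothesis: an invariant line at every `v ∣ p`. [folklore] -/
def FlagHyp (ρ : FramedGaloisRep F (PadicAlgCl p) 2) : Prop :=
  ∀ v : HeightOneSpectrum (𝓞 F), ((p : ℕ) : 𝓞 F) ∈ v.asIdeal →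
    FramedRep.HasInvariantCompleteFlag (ρ.toLocal v)

/-- The crux's conclusion: one `g` such that every label has weights `{a, a + g}`. [folklore] -/
def ParallelConcl (ρ : FramedGaloisRep F (PadicAlgCl p) 2) : Prop :=
  ∃ g : ℤ, ∀ (v : HeightOneSpectrum (𝓞 F)) (hv : ((p : ℕ) : 𝓞 F) ∈ v.asIdeal),
    letI := (fontainePstAdicCompletion v p hv).algebra
    ∀ τ : v.adicCompletion F →ₐ[ℚ_[p]] PadicAlgCl p, ∃ a : ℤ, HT ρ v hv τ.toRingHom = {a, a + g}

/-- `ρ` is a COUNTEREXAMPLE to the crux over `F` at `p`. [folklore] -/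
structure IsCounterexample (ρ : FramedGaloisRep F (PadicAlgCl p) 2) : Prop where
  irreducible : ρ.toGaloisRep.IsIrreducible
  unramified : ∀ᶠ v : HeightOneSpectrum (𝓞 F) in Filter.cofinite, ρ.IsUnramifiedAt v
  regular : RegularHyp ρ
  flag : FlagHyp ρ
  not_parallel : ¬ ParallelConcl ρ

end Vocabulary

/-- **The crux, restated** through the vocabulary of §0 (definitional). [folklore] -/
theorem locallyReducibleParallel_iff :
    Summit.Langlands.Langlands.Theses.NonParallelVoid.LocallyReducibleParallel ↔
      ∀ (F : Type) [Field F] [NumberField F] [Algebra.IsQuadraticExtension ℚ F],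
        NumberField.IsTotallyComplex F → ∀ (p : ℕ) [Fact p.Prime]
          (ρ : FramedGaloisRep F (PadicAlgCl p) 2), ρ.toGaloisRep.IsIrreducible →
          (∀ᶠ v : HeightOneSpectrum (𝓞 F) in Filter.cofinite, ρ.IsUnramifiedAt v) →
          RegularHyp ρ → FlagHyp ρ → ParallelConcl ρ :=
  Iff.rfl

/-- **No counterexample ⟺ the crux** (so a kill is exactly an `IsCounterexample` over an imaginary
quadratic field). [folklore] -/
theorem locallyReducibleParallel_iff_no_counterexample :
    Summit.Langlands.Langlands.Theses.NonParallelVoid.LocallyReducibleParallel ↔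
      ∀ (F : Type) [Field F] [NumberField F] [Algebra.IsQuadraticExtension ℚ F],
        NumberField.IsTotallyComplex F → ∀ (p : ℕ) [Fact p.Prime]
          (ρ : FramedGaloisRep F (PadicAlgCl p) 2), ¬ IsCounterexample ρ := by
  rw [locallyReducibleParallel_iff]
  refine forall_congr' fun F => forall_congr' fun _ => forall_congr' fun _ => forall_congr' fun _ =>
    forall_congr' fun _ => forall_congr' fun p => forall_congr' fun _ => forall_congr' fun ρ => ?_
  constructor
  · intro h hc
    exact hc.not_parallel (h hc.irreducible hc.unramified hc.regular hc.flag)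
  · intro h hirr hunr hreg hflag
    by_contra hnp
    exact h ⟨hirr, hunr, hreg, hflag, hnp⟩

/-! ## §1 Load-bearing analysis (paper witnesses; no Lean witness constructible, see §3) -/

/-- **Drop `IsTotallyComplex`** (allow real quadratic `F`).  FALSE on paper, witness: `F = ℚ(√5)`,
`f` a Hilbert cuspidal newform of non-parallel weight `(k₁, k₂) = (2, 4)` (they exist in every
sufficiently large level; paritious weights), `p` a prime at which `f` is ordinary and which splits
in `F`; `ρ = ρ_{f,p}` (Carayol, Taylor, Blasius–Rogawski) is irreducible, unramified outside `Np`,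
de Rham at both `v ∣ p` with `HT = {0, k_τ - 1} = {0,1}` and `{0,3}`, and ordinary (Wiles/Hida) hence
nearly ordinary at both places: gaps `1 ≠ 3`.  So ANY PROOF MUST USE `IsTotallyComplex F`.
Not constructible in Lean today (no Galois representation attached to a Hilbert form with computed
`B_dR`-weights exists in the tree; `CuspidalAutomorphicRepData 2 F` has no term). [folklore] -/
def LocallyReducibleParallelWithoutTotallyComplex : Prop :=
  ∀ (F : Type) [Field F] [NumberField F] [Algebra.IsQuadraticExtension ℚ F] (p : ℕ) [Fact p.Prime]
    (ρ : FramedGaloisRep F (PadicAlgCl p) 2), ρ.toGaloisRep.IsIrreducible →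
    (∀ᶠ v : HeightOneSpectrum (𝓞 F) in Filter.cofinite, ρ.IsUnramifiedAt v) →
    RegularHyp ρ → FlagHyp ρ → ParallelConcl ρ

/-- **Drop `Algebra.IsQuadraticExtension ℚ F`** (allow any totally complex `F`).  FALSE on paper for
the conclusion AS SHAPED ("all gaps equal"), witness: `F = F⁺·E` quartic CM with `F⁺ = ℚ(√5)`,
`ρ = ρ_{f,p}|Γ_F` for the weight-`(2,4)` ordinary Hilbert newform `f` of the previous docstring
(`p` split completely in `F`, `ρ̄|Γ_F` still irreducible for generic `f`): the four labels have gaps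
`1, 1, 3, 3`.  Over a general CM field the true statement is Clozel purity `gap_τ = gap_{τ∘c}`, which
coincides with "all gaps equal" exactly when `F` is imaginary quadratic.  So ANY PROOF MUST USE that
`F` is quadratic. [folklore] -/
def LocallyReducibleParallelWithoutQuadratic : Prop :=
  ∀ (F : Type) [Field F] [NumberField F], NumberField.IsTotallyComplex F → ∀ (p : ℕ) [Fact p.Prime]
    (ρ : FramedGaloisRep F (PadicAlgCl p) 2), ρ.toGaloisRep.IsIrreducible →
    (∀ᶠ v : HeightOneSpectrum (𝓞 F) in Filter.cofinite, ρ.IsUnramifiedAt v) →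
    RegularHyp ρ → FlagHyp ρ → ParallelConcl ρ

/-- **Drop irreducibility.**  FALSE on paper, witness: `F` imaginary quadratic, `p` split as `v ≠ w`,
`χ` the `p`-adic avatar (Weil; `HeckeCharacter.IsAlgebraic.exists_lAdic`) of an algebraic Hecke
character of `F` of infinity type `(2, 1)` (exists: the unit group of `F` is finite, so every
infinity type occurs, `HeckeCharacter.exists_of_unitaryArchParams_iff`; e.g. `ψ_E² ψ̄_E` for a CM
elliptic curve `E`), `ρ = 1 ⊕ χ`: unramified a.e., de Rham at `v, w` with `HT_v = {0, -2}`,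
`HT_w = {0, -1}` (Serre, *Abelian ℓ-adic representations* III; sign convention `HT(ε) = -1`),
trivially nearly ordinary (it is a sum of characters): gaps `2 ≠ 1`.  So ANY PROOF MUST USE
irreducibility — and uses it exactly to exclude sums of CM-type characters with different infinity
types.  Not constructible in Lean today: the tree has Weil's `χ` (`exists_lAdic`) and its de Rham-ness
as a NAMED FACT (`HeckeCharacter.exists_lAdic_isDeRhamFramed`) but NOT its labelled weights (the
dictionary "infinity type ↔ HT" is an explicit TODO of `DeRhamLAdicCharacterHecke`). [folklore] -/
def LocallyReducibleParallelWithoutIrreducible : Prop :=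
  ∀ (F : Type) [Field F] [NumberField F] [Algebra.IsQuadraticExtension ℚ F],
    NumberField.IsTotallyComplex F → ∀ (p : ℕ) [Fact p.Prime]
    (ρ : FramedGaloisRep F (PadicAlgCl p) 2),
    (∀ᶠ v : HeightOneSpectrum (𝓞 F) in Filter.cofinite, ρ.IsUnramifiedAt v) →
    RegularHyp ρ → FlagHyp ρ → ParallelConcl ρ

/-- **Drop the flag hypothesis** (no invariant line required): this is VERBATIM the route's
`Target` (`withoutFlag_iff_target`), the full parallel-weight conjecture for `GL₂` over imaginary
quadratic fields — open, not refutable (a witness is a counterexample to Fontaine–Mazur). [folklore] -/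
def LocallyReducibleParallelWithoutFlag : Prop :=
  ∀ (F : Type) [Field F] [NumberField F] [Algebra.IsQuadraticExtension ℚ F],
    NumberField.IsTotallyComplex F → ∀ (p : ℕ) [Fact p.Prime]
    (ρ : FramedGaloisRep F (PadicAlgCl p) 2), ρ.toGaloisRep.IsIrreducible →
    (∀ᶠ v : HeightOneSpectrum (𝓞 F) in Filter.cofinite, ρ.IsUnramifiedAt v) →
    RegularHyp ρ → ParallelConcl ρ

/-- Dropping the flag hypothesis gives back exactly `NonParallelVoid.Target` (definitional).
[folklore] -/
theorem withoutFlag_iff_target :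
    LocallyReducibleParallelWithoutFlag ↔ Summit.Langlands.Langlands.Theses.NonParallelVoid.Target :=
  Iff.rfl

/-- The crux is the flag-restricted part of `Target` (definitional bookkeeping: `Target` implies the
crux). [folklore] -/
theorem locallyReducibleParallel_of_target
    (h : Summit.Langlands.Langlands.Theses.NonParallelVoid.Target) :
    Summit.Langlands.Langlands.Theses.NonParallelVoid.LocallyReducibleParallel :=
  fun F _ _ _ hF p _ ρ hirr hunr hHT _ => h F hF p ρ hirr hunr hHT

/-- **Natural strengthening: uniform WEIGHTS, not only uniform gaps** (`∃ g a, ∀ labels,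
HT = {a, a+g}`).  FALSE on paper even on the known locus: twist a parallel `ρ` (e.g. `ρ_{E,p}|Γ_F`,
`E/ℚ` a non-CM elliptic curve ordinary at `p` split in `F`, `HT = {-1, 0}` at both labels) by the
`p`-adic avatar of a Hecke character of `F` of infinity type `(1, 0)`: the weights become
`{-2,-1}` at `v` and `{-1, 0}` at `w` — equal gaps, different weights.  Recorded so that no line
over-claims; not constructible in Lean (same CM-character obstruction as above). [folklore] -/
def UniformWeights : Prop :=
  ∀ (F : Type) [Field F] [NumberField F] [Algebra.IsQuadraticExtension ℚ F],
    NumberField.IsTotallyComplex F → ∀ (p : ℕ) [Fact p.Prime]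
    (ρ : FramedGaloisRep F (PadicAlgCl p) 2), ρ.toGaloisRep.IsIrreducible →
    (∀ᶠ v : HeightOneSpectrum (𝓞 F) in Filter.cofinite, ρ.IsUnramifiedAt v) →
    RegularHyp ρ → FlagHyp ρ →
    ∃ g a : ℤ, ∀ (v : HeightOneSpectrum (𝓞 F)) (hv : ((p : ℕ) : 𝓞 F) ∈ v.asIdeal),
      letI := (fontainePstAdicCompletion v p hv).algebra
      ∀ τ : v.adicCompletion F →ₐ[ℚ_[p]] PadicAlgCl p, HT ρ v hv τ.toRingHom = {a, a + g}

/-- The strengthening implies the crux (so refuting the crux refutes it; the converse fails on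
paper, previous docstring). [folklore] -/
theorem locallyReducibleParallel_of_uniformWeights (h : UniformWeights) :
    Summit.Langlands.Langlands.Theses.NonParallelVoid.LocallyReducibleParallel := by
  intro F _ _ _ hF p _ ρ hirr hunr hHT hflag
  obtain ⟨g, a, hga⟩ := h F hF p ρ hirr hunr hHT hflag
  exact ⟨g, fun v hv τ => ⟨a, hga v hv τ⟩⟩

/-! ## §2 Twist stability of the counterexample locus (PROVED)

`χ k = ε_p^{-k} = (cyclotomicPadicAlgCl F p ^ k)⁻¹ : Γ_F →ₜ* ℚ̄_pˣ`; the twist `ρ ⊗ χ k` is the accepted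
`FramedRep.twist`.  Everything below is unconditional except `deRham_twist` /
`IsCounterexample.twist`, which use the T0 named fact `FontaineDatumExists` through the accepted
`fontainePstAdicCompletion_isDeRhamFramed_tateTwist`. -/

section Twist

variable {F : Type} [Field F] [NumberField F] {p : ℕ} [Fact p.Prime]

variable (F p) in
/-- The twisting character `ε_p^{-k}` with values in `ℚ̄_pˣ`. [folklore] -/
abbrev χ (k : ℕ) : absoluteGaloisGroup F →ₜ* (PadicAlgCl p)ˣ := (cyclotomicPadicAlgCl F p ^ k)⁻¹

omit [NumberField F] in
/-- Values of `ε_p^{-k}` in `ℚ̄_p` (re-proved here; the accepted `coe_cycPowInv_apply` of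
`CyclotomicPowerTwistProofs` is not imported to keep this work file's import cone small). [folklore] -/
theorem coe_chi_apply (k : ℕ) (g : absoluteGaloisGroup F) :
    ((χ F p k) g : PadicAlgCl p) = ((cyclotomicPadicAlgCl F p g : PadicAlgCl p) ^ k)⁻¹ := by
  change ((((cyclotomicPadicAlgCl F p ^ k) g)⁻¹ : (PadicAlgCl p)ˣ) : PadicAlgCl p) = _
  rw [ContinuousMonoidHom.pow_apply, Units.val_inv_eq_inv_val, Units.val_pow_eq_pow_val]

/-- `ε_p^{-k}` is trivial on every inertia group away from `p` (inertia prime to `p` fixes the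
`p`-power roots of unity, accepted `smul_eq_self_of_mem_inertia_of_pow_prime_pow_eq_one`). [folklore] -/
theorem chi_eq_one_of_mem_inertia (k : ℕ) {v : HeightOneSpectrum (𝓞 F)}
    (hv : ((p : ℕ) : 𝓞 F) ∉ v.asIdeal) {𝔓 : Ideal (absIntegers (𝓞 F) F)} (h𝔓 : 𝔓 ∈ v.primesAbove)
    {σ : absoluteGaloisGroup F} (hσ : σ ∈ 𝔓.inertia (absoluteGaloisGroup F)) : χ F p k σ = 1 := by
  have hc : GaloisRep.cyclotomicCharacter F p σ = 1 := by
    rw [GaloisRep.cyclotomicCharacter_apply]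
    refine cyclotomicCharacter_eq_one_of_forall_pow_eq_one p _ fun n t ht => ?_
    exact smul_eq_self_of_mem_inertia_of_pow_prime_pow_eq_one hv h𝔓 hσ ht
  refine Units.ext ?_
  rw [coe_chi_apply, coe_cyclotomicPadicAlgCl_apply, hc, Units.val_one, PadicInt.coe_one, map_one,
    one_pow, inv_one, Units.val_one]

/-- Only finitely many finite places lie above `p` (re-proved; cf. the accepted
`eventually_natCast_not_mem_asIdeal`). [folklore] -/
theorem eventually_not_mem_asIdeal :
    ∀ᶠ v : HeightOneSpectrum (𝓞 F) in Filter.cofinite, ((p : ℕ) : 𝓞 F) ∉ v.asIdeal := by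
  have hI : Ideal.span {((p : ℕ) : 𝓞 F)} ≠ ⊥ := by
    rw [Ne, Ideal.span_singleton_eq_bot]
    exact_mod_cast (Fact.out : p.Prime).ne_zero
  rw [Filter.eventually_cofinite]
  refine (Ideal.finite_factors hI).subset fun v hv => ?_
  simp only [Set.mem_setOf_eq, not_not] at hv ⊢
  exact (Ideal.dvd_span_singleton).mpr hv

/-- On a decomposition group at `v`, `ε_p^{-k}` is the `(-k)`-th power of the LOCAL cyclotomic
character (the shape `hε` of the accepted twist theorems). [folklore] -/
theorem chi_absGaloisRestrict (k : ℕ) (v : HeightOneSpectrum (𝓞 F))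
    (σ : absoluteGaloisGroup (v.adicCompletion F)) :
    ((χ F p k) (absGaloisRestrict F (v.adicCompletion F) σ) : PadicAlgCl p) =
      (algebraMap ℚ_[p] (PadicAlgCl p)
        ((GaloisRep.cyclotomicCharacter (v.adicCompletion F) p σ : ℤ_[p]ˣ) : ℤ_[p])) ^ (-(k : ℤ)) := by
  haveI : NeZero (p : F) := ⟨Nat.cast_ne_zero.mpr (Fact.out : p.Prime).ne_zero⟩
  rw [coe_chi_apply, coe_cyclotomicPadicAlgCl_apply, cyclotomicCharacter_absGaloisRestrict,
    zpow_neg, zpow_natCast]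

/-- **Labelled weights of the twist**: `HT(ρ ⊗ ε_p^{-k}) = HT(ρ) + k` at every label of every
`v ∣ p` (accepted `labelledHodgeTateWeightsAt_twist_of_cyclotomic_zpow`, unconditional). [folklore] -/
theorem HT_twist (ρ : FramedGaloisRep F (PadicAlgCl p) 2) (k : ℕ) (v : HeightOneSpectrum (𝓞 F))
    (hv : ((p : ℕ) : 𝓞 F) ∈ v.asIdeal) (τ : v.adicCompletion F →+* PadicAlgCl p) :
    HT (FramedRep.twist ρ (χ F p k)) v hv τ = (HT ρ v hv τ).map fun i : ℤ => i + (k : ℤ) := by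
  have h := FramedGaloisRep.labelledHodgeTateWeightsAt_twist_of_cyclotomic_zpow ρ (χ F p k)
    (-(k : ℤ)) v hv (chi_absGaloisRestrict k v) τ
  dsimp only [HT]
  rw [h]
  congr 1
  funext i
  omega

/-- Translating a pair. [folklore] -/
theorem pair_map_add (a b c : ℤ) :
    (({a, b} : Multiset ℤ).map fun i => i + c) = {a + c, b + c} := by
  simp

/-- "Weights `{a, a+g}` at the label `(v, τ)`" is twist-invariant (same `g`). [folklore] -/
theorem parallelAt_twist_iff (ρ : FramedGaloisRep F (PadicAlgCl p) 2) (k : ℕ) (g : ℤ)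
    (v : HeightOneSpectrum (𝓞 F)) (hv : ((p : ℕ) : 𝓞 F) ∈ v.asIdeal)
    (τ : v.adicCompletion F →+* PadicAlgCl p) :
    (∃ a : ℤ, HT (FramedRep.twist ρ (χ F p k)) v hv τ = {a, a + g}) ↔
      ∃ a : ℤ, HT ρ v hv τ = {a, a + g} := by
  rw [HT_twist]
  constructor
  · rintro ⟨a, ha⟩
    refine ⟨a - k, Multiset.map_injective (add_left_injective (k : ℤ)) ?_⟩
    rw [ha, pair_map_add, show a - (k : ℤ) + k = a by omega,
      show a - (k : ℤ) + g + k = a + g by omega]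
  · rintro ⟨a, ha⟩
    refine ⟨a + k, ?_⟩
    rw [ha, pair_map_add, show a + g + (k : ℤ) = a + k + g by omega]

/-- "Two distinct weights at the label `(v, τ)`" is twist-invariant. [folklore] -/
theorem regularAt_twist_iff (ρ : FramedGaloisRep F (PadicAlgCl p) 2) (k : ℕ)
    (v : HeightOneSpectrum (𝓞 F)) (hv : ((p : ℕ) : 𝓞 F) ∈ v.asIdeal)
    (τ : v.adicCompletion F →+* PadicAlgCl p) :
    (∃ a b : ℤ, a < b ∧ HT (FramedRep.twist ρ (χ F p k)) v hv τ = {a, b}) ↔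
      ∃ a b : ℤ, a < b ∧ HT ρ v hv τ = {a, b} := by
  rw [HT_twist]
  constructor
  · rintro ⟨a, b, hab, h⟩
    refine ⟨a - k, b - k, by omega, Multiset.map_injective (add_left_injective (k : ℤ)) ?_⟩
    rw [h, pair_map_add, sub_add_cancel, sub_add_cancel]
  · rintro ⟨a, b, hab, h⟩
    exact ⟨a + k, b + k, by omega, by rw [h, pair_map_add]⟩

/-- **The conclusion is twist-invariant.** [folklore] -/
theorem parallelConcl_twist_iff (ρ : FramedGaloisRep F (PadicAlgCl p) 2) (k : ℕ) :
    ParallelConcl (FramedRep.twist ρ (χ F p k)) ↔ ParallelConcl ρ := by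
  refine exists_congr fun g => forall_congr' fun v => forall_congr' fun hv =>
    forall_congr' fun τ => ?_
  letI := (fontainePstAdicCompletion v p hv).algebra
  exact parallelAt_twist_iff ρ k g v hv τ.toRingHom

/-- `toLocal` of a twist is the twist of `toLocal` (definitional). [folklore] -/
theorem toLocal_twist (ρ : FramedGaloisRep F (PadicAlgCl p) 2)
    (ε : absoluteGaloisGroup F →ₜ* (PadicAlgCl p)ˣ) (v : HeightOneSpectrum (𝓞 F)) :
    FramedGaloisRep.toLocal v (FramedRep.twist ρ ε) =
      FramedRep.twist (ρ.toLocal v) (ε.comp (absGaloisRestrict F (v.adicCompletion F))) :=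
  ContinuousMonoidHom.ext fun _ => rfl

/-- **De Rham-ness at `v ∣ p` is preserved by the twist** (under `FontaineDatumExists`, accepted
`fontainePstAdicCompletion_isDeRhamFramed_tateTwist`). [folklore] -/
theorem deRham_twist (hFD : FontaineDatumExists) (ρ : FramedGaloisRep F (PadicAlgCl p) 2) (k : ℕ)
    (v : HeightOneSpectrum (𝓞 F)) (hv : ((p : ℕ) : 𝓞 F) ∈ v.asIdeal)
    (h : (fontainePstAdicCompletion v p hv).IsDeRhamFramed (ρ.toLocal v)) :
    (fontainePstAdicCompletion v p hv).IsDeRhamFramed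
      (FramedGaloisRep.toLocal v (FramedRep.twist ρ (χ F p k))) := by
  rw [toLocal_twist]
  exact fontainePstAdicCompletion_isDeRhamFramed_tateTwist hFD v hv h (-(k : ℤ)) _
    (fun σ => chi_absGaloisRestrict k v σ)

/-- **The regularity hypothesis is preserved by the twist** (de Rham part under
`FontaineDatumExists`; the weight part unconditionally, `regularAt_twist_iff`). [folklore] -/
theorem regularHyp_twist (hFD : FontaineDatumExists) (ρ : FramedGaloisRep F (PadicAlgCl p) 2)
    (k : ℕ) (h : RegularHyp ρ) : RegularHyp (FramedRep.twist ρ (χ F p k)) := by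
  intro v hv
  letI := (fontainePstAdicCompletion v p hv).algebra
  refine ⟨deRham_twist hFD ρ k v hv (h v hv).1, fun τ => ?_⟩
  exact (regularAt_twist_iff ρ k v hv τ.toRingHom).2 ((h v hv).2 τ)

/-- **Invariant flags are preserved by the twist** (scalars are central: the same change of frame
triangularises `ρ ⊗ χ`). [folklore] -/
theorem flag_twist (ρ : FramedGaloisRep F (PadicAlgCl p) 2)
    (ε : absoluteGaloisGroup F →ₜ* (PadicAlgCl p)ˣ) (v : HeightOneSpectrum (𝓞 F))
    (h : FramedRep.HasInvariantCompleteFlag (ρ.toLocal v)) :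
    FramedRep.HasInvariantCompleteFlag (FramedGaloisRep.toLocal v (FramedRep.twist ρ ε)) := by
  obtain ⟨P, hP⟩ := h
  refine ⟨P, fun g i j hij => ?_⟩
  have key : (FramedRep.conj P (FramedGaloisRep.toLocal v (FramedRep.twist ρ ε))).matrixFn g i j =
      (ε (absGaloisRestrict F (v.adicCompletion F) g) : PadicAlgCl p) *
        (FramedRep.conj P (ρ.toLocal v)).matrixFn g i j := by
    rw [toLocal_twist, FramedRep.conj_twist, FramedRep.matrixFn_apply, FramedRep.coe_twist_apply,
      Matrix.smul_apply, smul_eq_mul, FramedRep.matrixFn_apply]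
    rfl
  rw [key, hP g i j hij, mul_zero]

/-- **The flag hypothesis is preserved by the twist.** [folklore] -/
theorem flagHyp_twist (ρ : FramedGaloisRep F (PadicAlgCl p) 2)
    (ε : absoluteGaloisGroup F →ₜ* (PadicAlgCl p)ˣ) (h : FlagHyp ρ) :
    FlagHyp (FramedRep.twist ρ ε) :=
  fun v hv => flag_twist ρ ε v (h v hv)

/-- Subrepresentations of a representation and of its twist by a unit-valued scalar function are
the same submodules: an order isomorphism. [folklore] -/
def subrepresentationEquivOfSMul {k G V : Type*} [Field k] [Monoid G] [AddCommGroup V] [Module k V]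
    (ρ₁ ρ₂ : Representation k G V) (c : G → kˣ) (h : ∀ g v, ρ₂ g v = (c g : k) • ρ₁ g v) :
    Subrepresentation ρ₁ ≃o Subrepresentation ρ₂ where
  toFun W := ⟨W.toSubmodule, fun g v hv => by
    rw [h]
    exact W.toSubmodule.smul_mem _ (W.apply_mem_toSubmodule g hv)⟩
  invFun W := ⟨W.toSubmodule, fun g v hv => by
    have e : ρ₁ g v = (((c g)⁻¹ : kˣ) : k) • ρ₂ g v := by
      rw [h, smul_smul, Units.inv_mul, one_smul]
    rw [e]
    exact W.toSubmodule.smul_mem _ (W.apply_mem_toSubmodule g hv)⟩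
  left_inv W := rfl
  right_inv W := rfl
  map_rel_iff' := Iff.rfl

omit [NumberField F] in
/-- **Irreducibility is preserved by the twist.** [folklore] -/
theorem irreducible_twist (ρ : FramedGaloisRep F (PadicAlgCl p) 2)
    (ε : absoluteGaloisGroup F →ₜ* (PadicAlgCl p)ˣ) (h : ρ.toGaloisRep.IsIrreducible) :
    (FramedGaloisRep.toGaloisRep (FramedRep.twist ρ ε)).IsIrreducible := by
  have e := subrepresentationEquivOfSMul ρ.toGaloisRep.toRepresentation
    (FramedGaloisRep.toGaloisRep (FramedRep.twist ρ ε)).toRepresentation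
    (fun g => ε g) (fun g v => by
      change (FramedRep.twist ρ ε).toContinuousRep g v = (ε g : PadicAlgCl p) • ρ.toContinuousRep g v
      rw [FramedRep.toContinuousRep_apply_apply, FramedRep.toContinuousRep_apply_apply,
        FramedRep.coe_twist_apply, Matrix.smul_mulVec])
  unfold ContinuousRep.IsIrreducible Representation.IsIrreducible at h ⊢
  exact e.isSimpleOrder_iff.1 h

/-- **Almost-everywhere unramifiedness is preserved by the twist** (`ε_p` is unramified away from
`p`, `chi_eq_one_of_mem_inertia`; finitely many places divide `p`). [folklore] -/
theorem unramified_twist (ρ : FramedGaloisRep F (PadicAlgCl p) 2) (k : ℕ)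
    (h : ∀ᶠ v : HeightOneSpectrum (𝓞 F) in Filter.cofinite, ρ.IsUnramifiedAt v) :
    ∀ᶠ v : HeightOneSpectrum (𝓞 F) in Filter.cofinite,
      FramedGaloisRep.IsUnramifiedAt v (FramedRep.twist ρ (χ F p k)) := by
  filter_upwards [h, eventually_not_mem_asIdeal (F := F) (p := p)] with v hv hvp
  intro 𝔓 h𝔓 σ hσ
  have h1 : ρ σ = 1 := hv 𝔓 h𝔓 σ hσ
  rw [FramedRep.twist_apply, h1, mul_one, chi_eq_one_of_mem_inertia k hvp h𝔓 hσ, map_one]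

/-- **The counterexample locus is stable under `ρ ↦ ρ ⊗ ε_p^{-k}`** (under the T0 fact
`FontaineDatumExists`, used only for the de Rham clause).  Consequences: (i) twisting the
Lean-constructible (parallel) representations never yields a witness; (ii) a prover may normalise
`ρ` by a Tate twist — e.g. make the smaller weight `0` at one chosen label — without loss. [folklore] -/
theorem IsCounterexample.twist (hFD : FontaineDatumExists) {ρ : FramedGaloisRep F (PadicAlgCl p) 2}
    (h : IsCounterexample ρ) (k : ℕ) : IsCounterexample (FramedRep.twist ρ (χ F p k)) where
  irreducible := irreducible_twist ρ _ h.irreducible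
  unramified := unramified_twist ρ k h.unramified
  regular := regularHyp_twist hFD ρ k h.regular
  flag := flagHyp_twist ρ _ h.flag
  not_parallel := fun hc => h.not_parallel ((parallelConcl_twist_iff ρ k).1 hc)

end Twist

/-! ## §3 Why nothing in reach is a witness (documentation)

**Lean-constructible representations with computed `B_dR`-weights** (exhaustive for the accepted
tree, 2026-08-17): unramified and finite-image local representations (`HT_τ = {0,…,0}`:
`BdRUnramified`, `BdRFiniteImage`, clause (F3)); powers of the cyclotomic character
(`HT_τ(ε^m) = {-m}`, clause (F11) under `FontaineDatumExists`); Tate twists of any of these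
(`HT ↦ HT - j`, unconditional).  Block sums (`FramedRep.blockSum`) have no weight lemma yet, but
would again be label-independent.  Every such `ρ` has the SAME multiset at both labels of `F`
(the constructions do not see the label), hence satisfies `ParallelConcl` whenever it satisfies
`RegularHyp` — no witness, for an honest reason (not vacuity: the hypotheses are satisfiable in
nature, e.g. `ρ_{E,p}|Γ_F` for a non-CM elliptic curve `E/ℚ` ordinary at `p`).

**The induced sector on paper.**  `ρ = Ind_{Γ_L}^{Γ_F} ψ`, `L/F` quadratic, `ψ : Γ_L → ℚ̄_pˣ`
Hodge–Tate at the places above `p`.  Restricting `ψ` to the global units through class field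
theory: a continuous character of `∏_{w ∤ p} 𝒪_w^×` into `Eˣ` has FINITE image (pro-prime-to-`p`
groups and `∏ k_w^×` have no `ℤ_p`-quotient), so the algebraic character `∏_τ̃ τ̃^{-n_τ̃}` giving
`ψ` on `𝒪_{L,p}^×` kills a finite-index subgroup of `𝒪_L^×`; by Weil/Serre (type `A₀`) the
infinity type `(n_τ̃)` factors through the maximal CM subfield `L_cm`.  If `L` is not CM then
`L_cm = F` and `HT_τ(ρ) = {n, n}` is IRREGULAR (excluded by `RegularHyp`); if `L` is CM then
`L = F·K₀` is biquadratic, the type is `(a, a'; w-a, w-a')` and the gaps are `|a-a'|` at BOTH labels —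
parallel.  (This needs neither "unramified a.e." nor the flag: in the induced sector those two
hypotheses are NOT load-bearing.)  The non-induced sector is Fontaine–Mazur territory: no witness is
known, and Calegari–Mazur conjecture there is none.

**Literature checked this cycle** (beyond the route's): ACC+ arXiv:1812.09999 pp. 64 (Thm 6.1.1,
6.1.2, Rem 6.1.3–6.1.4); Miagkov–Thorne arXiv:2203.04520 p. 3 (Thm 1.2 FL-crystalline, Thm 1.3
ordinary, both with the scalar-element hypothesis, `p > n`); negatives index (4 Langlands entries,
unrelated). -/

/-! ## §4 -- Line potaut (lead prover-line-stmt-Langlands-17002-0; skeleton `Lines/potaut.lean`)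

Joint sufficiency: `LocallyReducibleParallel_of` is kernel-checked from the five stubs — no gap can
hide in the composition; only a FALSE stub could sink the line.

* `stub_potAut_splitBigImage` (7 ≤ p split, ρ̄|Γ_{F(ζ_p)} abs. irreducible ⇒ potentially automorphic
  over some CM `F'`).  Lean: irrefutable AND unprovable today — the conclusion inhabits
  `CuspidalAutomorphicRepData 2 F' _`, which has no constructible term (named fact
  `nonempty_cuspidalAutomorphicRepData_two`).  Paper: implied by Fontaine–Mazur; at least as strong as
  the crux on its sector (by design).  FINDING (a): the printed engines' extra hypothesis
  "∃ σ ∈ G_{F'} ∖ G_{F'(ζ_p)}, ρ̄(σ) scalar" (ACC+ 6.1.2, MT 1.3) is AUTOMATIC here: `p` split in `F`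
  ⇒ `F ∩ ℚ(ζ_p) = ℚ` ⇒ `[F(ζ_p) : F] = p - 1 ≥ 6`; by ACC+ Rem 6.1.4 failure needs a surjection
  `(ad ρ̄)(G_F) ↠ Gal(F(ζ_p)/F)`, and the irreducible finite subgroups of `PGL₂(𝔽̄_p)` (dihedral:
  abelianisation `C₂` or `C₂²`; `A₄`: `C₃`; `S₄`: `C₂`; `A₅`, `PSL₂(q)`: trivial; `PGL₂(q)`: `C₂`)
  have no cyclic quotient of order ≥ 6.  What remains un-printed is the residual POTENTIAL
  automorphy input (an `ι`-ordinary `π₀` on `GL₂/F'` with `r̄(π₀) ≅ ρ̄|Γ_{F'}`) for arbitrary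
  irreducible `ρ̄` — the lead's census already records this (Moret-Bailly step absent).
* `stub_potAut_bigImageResidue` (same, `¬(7 ≤ p ∧ split)`).  Lean: as above.  FINDING (b): besides
  the card's "mixed-sign flags" and "`p ≤ 5` adequacy" corners, the scalar-element hypothesis of
  EVERY printed ordinary lifting theorem over CM fields fails identically — over `F` and over every
  finite `F'/F` — when `ζ_p ∈ F̄^{ker ad ρ̄}`: always for `p = 2`; for `p = 3` and `F = ℚ(√-3)`
  (`F(ζ_3) = F`, the coset `G_F ∖ G_{F(ζ_3)}` is EMPTY); and for `p = 7`, `F = ℚ(√-7)` (7 ramified,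
  `[F(ζ_7):F] = 3`) with projectively tetrahedral `ρ̄` whose `A₄ ↠ C₃` quotient field is `ℚ(ζ_7)`
  (such `ρ̄` exist: the split embedding problem `V₄ ⋊ C₃` over the `C₃`-extension `ℚ(ζ_7)/F` is
  solvable, and projective representations of `G_F` lift by Tate).  These are additional honest
  open sub-corners of stub 2, not refutations.
* `stub_potAut_residuallyDegenerate` — the open core; on the induced sub-sector (`ρ̄` and `ρ`
  induced from `L = F·K₀`) it is TRUE by automorphic induction (`automorphicInduction_character`),
  consistent with §3.  No attack available.
* `stub_dictionary` — Lean: irrefutable (takes `π : CuspidalAutomorphicRepData`).  Paper: the single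
  affine map `(c, u)`, `u = ±1`, uniform over ALL labels and ALL `σ : F' → ℚ̄_p` over a label, is
  consistent: `HLTT.IsCompatible` + Chebotarev + Brauer–Nesbitt pin `(ρ|Γ_{F'})^{ss} ≅ r_ι(Π)`,
  labelled weights of a de Rham representation are invariant under finite restriction and
  semisimplification, and `HT_{ι⁻¹s}(r_ι(Π))` is ONE universal affine function of the `a`-multiset
  at `s` (AHTW 2026 Thm 1.2.1); `c ∈ ℂ` free absorbs the unitary/C-algebraic half-integer shift.
  No mis-statement found.
* `stub_purityGap` — landed p165845.

Targets (`payload.targets` / stuck stubs): none this cycle. -/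

/-! ## §5 Near-misses: none — this file is `sorry`-free. -/

end Summit.Langlands.Langlands.Cruxes.LocallyReducibleParallel.Disproof

end
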